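import Summits.BirchSwinnertonDyer.BirchSwinnertonDyer.Theorems.GenusKolyvaginAtTwoGenusPrimitiveSupplyAtTwoTwistingPrimeDepthTwoUnipotent
import HarnessLib

/-!
# Route `GenusKolyvaginAtTwo`, crux #2 `GenusPrimitiveSupplyAtTwo` (stmt-BirchSwinnertonDyer-22136):
# the inflation kernel at level `4` has at most two elements; the depth-`2` capstone ON THE HABITAT

Width seat `bsd-line-gk2-p4` g8, cell `bsd-f1-sign2`; helper (`--supports stmt-BirchSwinnertonDyer-22136`),
eleventh file of the twisting-prime series (after `…TwistingPrimeDepthTwoUnipotent`). THEOREMS ONLY: no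
definition, no named fact, no `sorry`; no item is closed; BSD is not proved by any of this.

* §25 `eq_of_forall_torsionFixing_four_h1Eval_eq_zero`: for `ρ̄_{W,2}` and `ρ_{W,4}` onto, two NON-ZERO classes
  of `H¹(ℚ, E[2])` dying on `Γ_{ℚ(E[4])}` are EQUAL (`#Inf H¹(Gal(ℚ(E[4])/ℚ), E[2]) ≤ 2`; Lawson–Wuthrich's
  `H¹(GL₂(ℤ/4), 𝔽₂²) = 𝔽₂` in the tree's currency `h1Eval`/`torsionFixing`); hence
  `exists_selmer_h1Eval_ne_four_of_card_eq_four`: with `#Sel₂(W) = 4` SOME Selmer class does not die on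
  `Γ_{ℚ(E[4])}` — the `W`-side non-entanglement hypothesis of the depth-`2` capstone is automatic on the habitat.
* §26 CAPSTONE ON THE HABITAT `exists_kolyvaginPrime_depthTwo_genusPair_selmer_of_cor34i_of_half`:
  `cor34i_singleton_rat` → [`W` globally minimal, `Δ < 0`, `ρ̄_{W,2}`, `ρ_{W,4}` onto, `#Sel₂(W) = 4`; `K` imaginary
  quadratic; `Wd` globally minimal model of `W^{(d_K)}`, `#Sel₂(Wd) = 2`; a rational `P ∈ Wd(ℚ)` with a half `Q`
  MOVED by `Γ_{ℚ(E[4])}`] → ∀ `B₀` ∃ prime `ℓ ∉ B₀`, `ℓ ≡ 7 (8)`, Kolyvagin for `(E, K, 2)` of DEPTH 2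
  (`4 ∣ ℓ + 1`, `4 ∣ a_ℓ`), every model of `W^{(−ℓ)}` with `#Sel₂ = 2`, every model of `Wd^{(−ℓ)}` with
  `#Sel₂ = 1`. So the ℓ-SUPPLY of the LEAD's auxiliary-field form of U (p615396) is kernel modulo cor34i (PRINT)
  and ONE decidable point condition on the twin: «the generator of `A(ℚ)/2` is not halvable in `A(ℚ(E[4]))`»
  (the ENTANGLED exception of `Lines/genus-supply-depthlaw.md` §2; MEMO-es §13: 2/510 twins). Habitat form
  `…_of_habitat` with the crux's binder `∀ n ≥ 1, ρ_{E,2^n}` onto.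

References: [LawsonWuthrich2016] §3; [MazurRubin2010] Cor. 3.4 (i); [GrossLMS1991] §3, §9.
-/

set_option linter.dupNamespace false -- tree convention: `Summit.BirchSwinnertonDyer.BirchSwinnertonDyer.Theorems` (summit = sub-problem)
set_option autoImplicit false

noncomputable section

open scoped Classical Pointwise

namespace Summit.BirchSwinnertonDyer.BirchSwinnertonDyer.Theorems.GenusKolyTwistingPrime

open WeierstrassCurve NumberField IsDedekindDomain Field
open Literature.NumberTheory.GaloisRepresentations Literature.NumberTheory.EllipticCurves
open Literature.NumberTheory Matrix

/-! ## §25 The inflation kernel `ker(H¹(ℚ, E[2]) → Hom(Γ_{ℚ(E[4])}, E[2]))` has at most two elements -/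

section InflationKernel

variable (W : WeierstrassCurve ℚ)

/-- **THE INFLATION KERNEL AT LEVEL `4` HAS AT MOST TWO ELEMENTS.** For `W/ℚ` elliptic with `ρ̄_{W,2}`
onto and `ρ_{W,4}` onto: two NON-ZERO classes `x, y ∈ H¹(ℚ, E[2])` which both die on `Γ_{ℚ(E[4])}`
(`[x, h] = [y, h] = 0` for all `h` fixing `E[4]`) are EQUAL — i.e. `#Inf H¹(Gal(ℚ(E[4])/ℚ), E[2]) ≤ 2`
(Lawson–Wuthrich: `H¹(GL₂(ℤ/4), 𝔽₂²) = 𝔽₂`). Proof: a dying class `z` gives the `Γ_ℚ`-equivariant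
homomorphism `ρ ↦ [z, ρ]` on `Γ_{ℚ(E[2])}/Γ_{ℚ(E[4])} ≅ {u_A} ≅ M₂(𝔽₂)` (`exists_smul_eq_add_apply_two_zsmul`,
`exists_smul_eq_add_of_mem_torsionFixing_two`), i.e. an additive `GL₂(𝔽₂)`-equivariant `F_z : M₂(𝔽₂) → 𝔽₂²`,
non-zero by Prop. 9.1 at `2`; by §23 `F_x = F_y`, whence `[x − y, ·] ≡ 0` on `Γ_{ℚ(E[2])}` and `x = y`.
[cite: LawsonWuthrich2016, §3 (Lemma 6 and the case p = 2)] [cite: GrossLMS1991, §9 Prop. 9.1] -/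
theorem eq_of_forall_torsionFixing_four_h1Eval_eq_zero [W.IsElliptic] (hsurj : W.HasSurjectiveModNGaloisRep 2)
    (hsurj4 : W.HasSurjectiveModNGaloisRep 4) {x y : galH1Torsion W (2 : ℤ)} (hx0 : x ≠ 0) (hy0 : y ≠ 0)
    (hx : ∀ h ∈ torsionFixing W (4 : ℤ), h1Eval W (2 : ℤ) x h = 0)
    (hy : ∀ h ∈ torsionFixing W (4 : ℤ), h1Eval W (2 : ℤ) y h = 0) : x = y := by
  classical
  have hT : torsionFixing W (4 : ℤ) ≤ torsionFixing W (2 : ℤ) :=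
    KolyvaginLowerBoundAtTwo.torsionFixing_le_of_dvd W (by norm_num)
  -- ### realisations `σ A` of the unipotents `u_A`, and the transfer of dying classes onto them
  choose σ hσ using fun A : geomTorsion W (2 : ℤ) →+ geomTorsion W (2 : ℤ) ↦
    exists_smul_eq_add_apply_two_zsmul W hsurj4 A
  have hσT : ∀ A, σ A ∈ torsionFixing W (2 : ℤ) := fun A ↦ mem_torsionFixing_two_of_smul_eq_add W A (hσ A)
  have transfer : ∀ {z : galH1Torsion W (2 : ℤ)}, (∀ h ∈ torsionFixing W (4 : ℤ), h1Eval W (2 : ℤ) z h = 0) →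
      ∀ (A : geomTorsion W (2 : ℤ) →+ geomTorsion W (2 : ℤ)) {ρ : absoluteGaloisGroup ℚ},
      (∀ P : geomTorsion W (4 : ℤ), ((ρ • P : geomTorsion W (4 : ℤ)) : geomPoints W) =
        (P : geomPoints W) + (A ⟨(2 : ℤ) • (P : geomPoints W), two_zsmul_mem_geomTorsion_two W P⟩ : geomPoints W)) →
      h1Eval W (2 : ℤ) z ρ = h1Eval W (2 : ℤ) z (σ A) := by
    intro z hz A ρ hρ
    have h4 : ρ * (σ A)⁻¹ ∈ torsionFixing W (4 : ℤ) :=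
      mul_inv_mem_torsionFixing_four_of_smul_eq_add W A (hσ A) hρ
    have e : ρ = (ρ * (σ A)⁻¹) * σ A := by group
    rw [e, h1Eval_mul W _ z (hT h4), hz _ h4, zero_add]
  -- ### a frame `E[2] ≃ 𝔽₂²`; matrices ↦ endomorphisms of `E[2]`
  haveI : Fact (Nat.Prime 2) := ⟨Nat.prime_two⟩
  have h2T : ∀ P : geomTorsion W (2 : ℤ), 2 • P = 0 := fun P ↦ AddSubgroup.torsionBy.nsmul P
  have hcard : Nat.card (geomTorsion W (2 : ℤ)) = 2 ^ 2 := natCard_geomTorsion_two_rat W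
  obtain ⟨e⟩ := KolyvaginImage.nonempty_addEquiv_of_card_eq_sq h2T hcard
  let endo : Matrix (Fin 2) (Fin 2) (ZMod 2) → (geomTorsion W (2 : ℤ) →+ geomTorsion W (2 : ℤ)) := fun M ↦
    e.symm.toAddMonoidHom.comp ((Matrix.toLin' M).toAddMonoidHom.comp e.toAddMonoidHom)
  have hendo : ∀ (M : Matrix (Fin 2) (Fin 2) (ZMod 2)) (v : geomTorsion W (2 : ℤ)),
      endo M v = e.symm (M *ᵥ e v) := fun M v ↦ by
    simp [endo, Matrix.toLin'_apply]
  have endo_add : ∀ M N : Matrix (Fin 2) (Fin 2) (ZMod 2), endo (M + N) = endo M + endo N := fun M N ↦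
    AddMonoidHom.ext fun v ↦ by rw [AddMonoidHom.add_apply, hendo, hendo, hendo, Matrix.add_mulVec, map_add]
  have endo_surj : ∀ A : geomTorsion W (2 : ℤ) →+ geomTorsion W (2 : ℤ), ∃ M, endo M = A := by
    intro A
    refine ⟨LinearMap.toMatrix' ((e.toAddMonoidHom.comp (A.comp e.symm.toAddMonoidHom)).toZModLinearMap 2), ?_⟩
    refine AddMonoidHom.ext fun v ↦ ?_
    rw [hendo, ← Matrix.toLin'_apply, Matrix.toLin'_toMatrix']
    apply e.symm_apply_eq.mpr
    simp
  -- ### the additive map `F_z : M₂(𝔽₂) → 𝔽₂²` of a dying class `z`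
  have addF : ∀ {z : galH1Torsion W (2 : ℤ)}, (∀ h ∈ torsionFixing W (4 : ℤ), h1Eval W (2 : ℤ) z h = 0) →
      ∀ M N : Matrix (Fin 2) (Fin 2) (ZMod 2), e (h1Eval W (2 : ℤ) z (σ (endo (M + N)))) =
        e (h1Eval W (2 : ℤ) z (σ (endo M))) + e (h1Eval W (2 : ℤ) z (σ (endo N))) := by
    intro z hz M N
    rw [← map_add, endo_add,
      ← transfer hz (endo M + endo N) (smul_eq_add_mul W (endo M) (endo N) (hσ _) (hσ _)),
      h1Eval_mul W _ z (hσT _)]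
  let F : ∀ z : galH1Torsion W (2 : ℤ), (∀ h ∈ torsionFixing W (4 : ℤ), h1Eval W (2 : ℤ) z h = 0) →
      (Matrix (Fin 2) (Fin 2) (ZMod 2) →+ (Fin 2 → ZMod 2)) := fun z hz ↦
    AddMonoidHom.mk' (fun M ↦ e (h1Eval W (2 : ℤ) z (σ (endo M)))) (addF hz)
  have hF : ∀ (z : galH1Torsion W (2 : ℤ)) (hz : ∀ h ∈ torsionFixing W (4 : ℤ), h1Eval W (2 : ℤ) z h = 0)
      (M : Matrix (Fin 2) (Fin 2) (ZMod 2)), F z hz M = e (h1Eval W (2 : ℤ) z (σ (endo M))) := fun z hz M ↦ rfl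
  -- ### equivariance under `GL₂(𝔽₂)` (every automorphism of `E[2]` is Galois: `ρ̄_{W,2}` onto)
  have equiv : ∀ (z : galH1Torsion W (2 : ℤ)) (hz : ∀ h ∈ torsionFixing W (4 : ℤ), h1Eval W (2 : ℤ) z h = 0)
      (g g' M : Matrix (Fin 2) (Fin 2) (ZMod 2)), g * g' = 1 → F z hz (g * M * g') = g *ᵥ F z hz M := by
    intro z hz g g' M hgg'
    have hg'g : g' * g = 1 := mul_eq_one_comm.mp hgg'
    let φ : geomTorsion W (2 : ℤ) ≃+ geomTorsion W (2 : ℤ) :=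
      { toFun := fun v ↦ e.symm (g *ᵥ e v)
        invFun := fun v ↦ e.symm (g' *ᵥ e v)
        left_inv := fun v ↦ by
          show e.symm (g' *ᵥ e (e.symm (g *ᵥ e v))) = v
          rw [e.apply_symm_apply, Matrix.mulVec_mulVec, hg'g, Matrix.one_mulVec, e.symm_apply_apply]
        right_inv := fun v ↦ by
          show e.symm (g *ᵥ e (e.symm (g' *ᵥ e v))) = v
          rw [e.apply_symm_apply, Matrix.mulVec_mulVec, hgg', Matrix.one_mulVec, e.symm_apply_apply]
        map_add' := fun v w ↦ by
          show e.symm (g *ᵥ e (v + w)) = e.symm (g *ᵥ e v) + e.symm (g *ᵥ e w)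
          rw [map_add, Matrix.mulVec_add, map_add] }
    obtain ⟨τ, hτ⟩ := hsurj (Multiplicative.ofAdd φ)
    have hτv : ∀ v : geomTorsion W (2 : ℤ), τ • v = e.symm (g *ᵥ e v) := fun v ↦ by
      have h := galoisRepTorsion_apply W (2 : ℤ) τ v
      rw [hτ, toAdd_ofAdd] at h
      exact h.symm
    have hτ'v : ∀ v : geomTorsion W (2 : ℤ), τ⁻¹ • v = e.symm (g' *ᵥ e v) := fun v ↦ by
      have h : τ • (e.symm (g' *ᵥ e v)) = v := by
        rw [hτv, e.apply_symm_apply, Matrix.mulVec_mulVec, hgg', Matrix.one_mulVec, e.symm_apply_apply]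
      nth_rewrite 1 [← h]
      rw [inv_smul_smul]
    have hconj : endo (g * M * g') = (DistribSMul.toAddMonoidHom (geomTorsion W (2 : ℤ)) τ).comp
        ((endo M).comp (DistribSMul.toAddMonoidHom (geomTorsion W (2 : ℤ)) τ⁻¹)) :=
      AddMonoidHom.ext fun v ↦ by
        show endo (g * M * g') v = τ • (endo M (τ⁻¹ • v))
        rw [hendo, hτ'v, hendo, e.apply_symm_apply, hτv, e.apply_symm_apply, Matrix.mulVec_mulVec,
          Matrix.mulVec_mulVec]
    rw [hF z hz, hF z hz, hconj, ← transfer hz _ (smul_eq_add_conj W (endo M) (hσ (endo M)) τ),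
      h1Eval_conj W _ z τ (hσT _), hτv, e.apply_symm_apply]
  -- ### non-vanishing (Prop. 9.1 at `2`: a non-zero class does not die on `Γ_{ℚ(E[2])}`)
  have nonzero : ∀ (z : galH1Torsion W (2 : ℤ)) (hz : ∀ h ∈ torsionFixing W (4 : ℤ), h1Eval W (2 : ℤ) z h = 0),
      z ≠ 0 → F z hz ≠ 0 := by
    intro z hz hz0 hF0
    apply hz0
    apply h1_restriction_injective_two_rat W hsurj
    intro ρ hρ
    obtain ⟨A, hA⟩ := exists_smul_eq_add_of_mem_torsionFixing_two W hρ
    obtain ⟨M, hM⟩ := endo_surj A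
    have h := DFunLike.congr_fun hF0 M
    rw [AddMonoidHom.zero_apply, hF z hz, hM, ← transfer hz A hA] at h
    exact (map_eq_zero_iff e e.injective).mp h
  -- ### §23: `F_x = F_y`; hence `[x, ·] = [y, ·]` on `Γ_{ℚ(E[2])}`, and `x = y`
  have hFeq : F x hx = F y hy :=
    twoByTwo_equivariant_unique _ _ (equiv x hx) (equiv y hy) (nonzero x hx hx0) (nonzero y hy hy0)
  have hsub : ∀ ρ ∈ torsionFixing W (2 : ℤ), h1Eval W (2 : ℤ) (x - y) ρ = 0 := by
    intro ρ hρ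
    obtain ⟨A, hA⟩ := exists_smul_eq_add_of_mem_torsionFixing_two W hρ
    obtain ⟨M, hM⟩ := endo_surj A
    have h := DFunLike.congr_fun hFeq M
    rw [hF x hx, hF y hy, hM] at h
    have h' := e.injective h
    rw [← transfer hx A hA, ← transfer hy A hA] at h'
    rw [sub_eq_add_neg, h1Eval_add W _ x (-y) hρ, h1Eval_neg W _ y hρ, h', add_neg_cancel]
  exact sub_eq_zero.mp (h1_restriction_injective_two_rat W hsurj hsub)

/-- **On the habitat the `W`-side non-entanglement at depth `2` is AUTOMATIC.** For `W/ℚ` elliptic with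
`ρ̄_{W,2}` and `ρ_{W,4}` onto and `#Sel₂(W) = 4` (WALL row 1), SOME Selmer class does not die on
`Γ_{ℚ(E[4])}`: the inflation kernel has at most two elements (`eq_of_forall_torsionFixing_four_h1Eval_eq_zero`)
and `Sel₂(W)` has four. [cite: LawsonWuthrich2016, §3] [cite: GrossLMS1991, §9 Prop. 9.1] -/
theorem exists_selmer_h1Eval_ne_four_of_card_eq_four [W.IsElliptic] (hsurj : W.HasSurjectiveModNGaloisRep 2)
    (hsurj4 : W.HasSurjectiveModNGaloisRep 4) (h4 : Nat.card (W.selmerGroup 2) = 4) :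
    ∃ c ∈ W.selmerGroup 2, ∃ h ∈ torsionFixing W ((2 ^ 2 : ℕ) : ℤ), h1Eval W (2 : ℤ) c h ≠ 0 := by
  have e4 : ((2 ^ 2 : ℕ) : ℤ) = 4 := by norm_num
  rw [e4]
  by_contra hcon
  push Not at hcon
  -- pick `x ≠ 0` in `Sel₂(W)`, then `y ∈ Sel₂(W) ∖ {0, x}` (`#Sel₂ = 4 ∤ 2`)
  have hne : ∃ x ∈ W.selmerGroup 2, x ≠ 0 := by
    by_contra h
    push Not at h
    have : Nat.card (W.selmerGroup 2) = 1 := by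
      rw [(AddSubgroup.eq_bot_iff_forall _).mpr h, AddSubgroup.card_bot]
    omega
  obtain ⟨x, hxS, hx0⟩ := hne
  have hx2 : addOrderOf x = 2 := by
    have h2 : (2 : ℕ) • x = 0 := by
      rw [← natCast_zsmul]
      exact_mod_cast zsmul_galH1Torsion_eq_zero W (2 : ℤ) x
    have hdvd : addOrderOf x ∣ 2 := addOrderOf_dvd_of_nsmul_eq_zero h2
    have hne1 : addOrderOf x ≠ 1 := by rw [Ne, AddMonoid.addOrderOf_eq_one_iff]; exact hx0
    rcases (Nat.dvd_prime Nat.prime_two).mp hdvd with h | h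
    · exact absurd h hne1
    · exact h
  have hne' : ∃ y ∈ W.selmerGroup 2, y ≠ 0 ∧ y ≠ x := by
    by_contra h
    push Not at h
    have hle : W.selmerGroup 2 ≤ AddSubgroup.zmultiples x := by
      intro y hy
      by_cases hy0 : y = 0
      · rw [hy0]; exact zero_mem _
      · rw [h y hy hy0]; exact AddSubgroup.mem_zmultiples x
    have hdvd := AddSubgroup.card_dvd_of_le hle
    rw [Nat.card_zmultiples, hx2, h4] at hdvd
    omega
  obtain ⟨y, hyS, hy0, hyx⟩ := hne'
  exact hyx (eq_of_forall_torsionFixing_four_h1Eval_eq_zero W hsurj hsurj4 hy0 hx0 (hcon y hyS) (hcon x hxS))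

end InflationKernel

/-! ## §26 The depth-`2` capstone on the habitat: only the twin's point condition remains -/

section HabitatCapstone

variable (W : WeierstrassCurve ℚ) [W.IsElliptic] [W.IsGloballyMinimal] {K : Type} [Field K] [NumberField K]

/-- **DEPTH-2 SUPPLY OF THE AUXILIARY-FIELD FORM, ON THE HABITAT, modulo cor34i and the twin's point condition
ONLY.** `W/ℚ` globally minimal, `Δ(W) < 0`, `ρ̄_{W,2}` and `ρ_{W,4}` onto, `#Sel₂(W) = 4`; `K` imaginary quadratic;
`Wd` a globally minimal model of `W^{(d_K)}` with `#Sel₂(Wd) = 2`; a rational point `P ∈ Wd(ℚ)` and a half `Q`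
(`2Q = P`) moved by SOME element of `Γ_{ℚ(E[4])}` («`P` not halvable in `Wd` over `ℚ(E[4])`»). Then beyond every
finite `B₀`: a prime `ℓ ≡ 7 (mod 8)`, Kolyvagin for `(E, K, 2)` in Gross's sense, of DEPTH `2`
(`FrobEqFrobInfty W K 4 ℓ`, `4 ∣ ℓ + 1`, `4 ∣ a_ℓ(W)`), with every elliptic model of `W^{(−ℓ)}` having
`#Sel₂ = 2` and every elliptic model of `Wd^{(−ℓ)}` having `#Sel₂ = 1`. The `W`-side hypothesis of
`exists_kolyvaginPrime_pow_genusPair_selmer_of_cor34i_of_half` is discharged by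
`exists_selmer_h1Eval_ne_four_of_card_eq_four`. BSD is not proved by this.
[cite: MazurRubin2010, Cor. 3.4 (i), Prop. 3.3, Lemma 3.5] [cite: LawsonWuthrich2016, §3]
[cite: GrossLMS1991, §3 (3.1)–(3.3), §9 Prop. 9.1] -/
theorem exists_kolyvaginPrime_depthTwo_genusPair_selmer_of_cor34i_of_half
    (h34 : MazurRubin2010.cor34i_singleton_rat)
    (hsurj : W.HasSurjectiveModNGaloisRep 2) (hsurj4 : W.HasSurjectiveModNGaloisRep 4) (hΔ : W.Δ < 0)
    (h4 : Nat.card (W.selmerGroup 2) = 4)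
    (hK : IsImaginaryQuadratic K) {Wd : WeierstrassCurve ℚ} [Wd.IsElliptic] [Wd.IsGloballyMinimal]
    {C : VariableChange ℚ} (hWd : C • W.quadraticTwist (discr K : ℚ) = Wd)
    (h2 : Nat.card (Wd.selmerGroup 2) = 2)
    (P : Wd.toAffine.Point) (Q : geomPoints Wd) (hQ : (2 : ℤ) • Q = toGeomPoints Wd P)
    (hmove : ∃ h ∈ torsionFixing W ((2 ^ 2 : ℕ) : ℤ), h • Q ≠ Q) (B₀ : Finset ℕ) :
    ∃ ℓ : ℕ, ∃ _ : Fact ℓ.Prime, ℓ ∉ B₀ ∧ ℓ % 8 = 7 ∧ IsKolyvaginPrime (W.conductorNorm ℤ) W K 2 ℓ ∧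
      FrobEqFrobInfty W K (2 ^ 2) ℓ ∧ 2 ^ 2 ∣ ℓ + 1 ∧ ((2 : ℤ) ^ 2) ∣ W.frobeniusTrace ℓ ∧
      (∀ (W₁ : WeierstrassCurve ℚ) [W₁.IsElliptic],
        (∃ C₁ : VariableChange ℚ, C₁ • W.quadraticTwist (-(ℓ : ℚ)) = W₁) →
          Nat.card (W₁.selmerGroup 2) = 2) ∧
      (∀ (W₂ : WeierstrassCurve ℚ) [W₂.IsElliptic],
        (∃ C₂ : VariableChange ℚ, C₂ • Wd.quadraticTwist (-(ℓ : ℚ)) = W₂) →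
          Nat.card (W₂.selmerGroup 2) = 1) :=
  exists_kolyvaginPrime_pow_genusPair_selmer_of_cor34i_of_half W h34 hsurj hΔ h4 hK hWd h2 (by norm_num)
    (exists_selmer_h1Eval_ne_four_of_card_eq_four W hsurj hsurj4 h4) P Q hQ hmove B₀

/-- **The same with the crux's own image binder** `∀ n ≥ 1, ρ_{E,2^n}` onto (habitat of crux 22136 / U).
[cite: MazurRubin2010, Cor. 3.4 (i)] [cite: LawsonWuthrich2016, §3] -/
theorem exists_kolyvaginPrime_depthTwo_genusPair_selmer_of_cor34i_of_half_of_habitat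
    (h34 : MazurRubin2010.cor34i_singleton_rat)
    (hρ : ∀ n : ℕ, 0 < n → W.HasSurjectiveModNGaloisRep ((2 : ℤ) ^ n)) (hΔ : W.Δ < 0)
    (h4 : Nat.card (W.selmerGroup 2) = 4)
    (hK : IsImaginaryQuadratic K) {Wd : WeierstrassCurve ℚ} [Wd.IsElliptic] [Wd.IsGloballyMinimal]
    {C : VariableChange ℚ} (hWd : C • W.quadraticTwist (discr K : ℚ) = Wd)
    (h2 : Nat.card (Wd.selmerGroup 2) = 2)
    (P : Wd.toAffine.Point) (Q : geomPoints Wd) (hQ : (2 : ℤ) • Q = toGeomPoints Wd P)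
    (hmove : ∃ h ∈ torsionFixing W ((2 ^ 2 : ℕ) : ℤ), h • Q ≠ Q) (B₀ : Finset ℕ) :
    ∃ ℓ : ℕ, ∃ _ : Fact ℓ.Prime, ℓ ∉ B₀ ∧ ℓ % 8 = 7 ∧ IsKolyvaginPrime (W.conductorNorm ℤ) W K 2 ℓ ∧
      FrobEqFrobInfty W K (2 ^ 2) ℓ ∧ 2 ^ 2 ∣ ℓ + 1 ∧ ((2 : ℤ) ^ 2) ∣ W.frobeniusTrace ℓ ∧
      (∀ (W₁ : WeierstrassCurve ℚ) [W₁.IsElliptic],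
        (∃ C₁ : VariableChange ℚ, C₁ • W.quadraticTwist (-(ℓ : ℚ)) = W₁) →
          Nat.card (W₁.selmerGroup 2) = 2) ∧
      (∀ (W₂ : WeierstrassCurve ℚ) [W₂.IsElliptic],
        (∃ C₂ : VariableChange ℚ, C₂ • Wd.quadraticTwist (-(ℓ : ℚ)) = W₂) →
          Nat.card (W₂.selmerGroup 2) = 1) := by
  have hsurj : W.HasSurjectiveModNGaloisRep 2 := by simpa using hρ 1 one_pos
  have hsurj4 : W.HasSurjectiveModNGaloisRep 4 := by
    have h := hρ 2 two_pos
    norm_num at h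
    exact h
  exact exists_kolyvaginPrime_depthTwo_genusPair_selmer_of_cor34i_of_half W h34 hsurj hsurj4 hΔ h4 hK hWd h2 P Q
    hQ hmove B₀

end HabitatCapstone

end Summit.BirchSwinnertonDyer.BirchSwinnertonDyer.Theorems.GenusKolyTwistingPrime

end
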